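import Summits.QuantumFields.BalabanUV.Beta.WardLocusQuarticWall
import Summits.QuantumFields.BalabanUV.Beta.KernelWardSymAssembly
import Summits.QuantumFields.BalabanUV.Beta.SecondOrderRemainderTables
import Summits.QuantumFields.BalabanUV.Beta.WardLocusRecursiveEnd

/-!
# `BalabanUV.Beta.WardLocusRecursiveStep` — binder row D1, (L4) W-side of hW, «D1-hW-L4-WARD-ALL» part B: THE KERNEL LAW `hWd j` OF THE W-LITERAL
# `WrecAt j` AT ANY LEVEL `j` FROM ITS LEVEL-`j` TABLE LAWS — leaf-10's `KernelWardSymAssembly.divW_W2SymOfK_eq_conjV_add_residuals` at the wall objects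
# `K := G_j = coDressKBmAt ρ Lc (KInvStep Lc j)`, `𝕄 := bhKStepAt j`, `E := axEc ρ Lc`, `S := SpureRecAt j`, `M := M1At j`, `S₂ := T2RecAt j`, `M₂ := M2Of mixFF j`,
# with EVERY resolvent / first-order socket discharged BY NAME; plus the localisation of the residual
# (β sub-cell, D1 formalisation swarm, unit `b2b-balaban-beta-d1-formalise-leaf-06`, gen 3; INTENT «D1-hW-L4-WARD-ALL» journal 2026-08-20T12:24Z)

NOT IN PRINT; OUR BOOKKEEPING.  HONEST FRAMING (cell charter, verbatim): «discharging `BetaPertH` makes Bałaban's UV stability UNCONDITIONAL — a real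
constructive-QFT result; it is NOT the continuum limit and NOT the Clay problem.»  HONEST DEPENDENCY (verbatim): «continuum YM on T⁴ ⇐ BetaPertH ∧ nine spine
estimates (0/9 proved); BetaPertH ⇐ (D1) ∧ (D4) ∧ CAP+tail; G-an2-4 gates asym, D1 and NE2/3/4.»  [folklore] kernel algebra over tree objects BY NAME; the three
level-`j` TABLE laws (`hS₂`, `hS₂''` of `T2RecAt j` against `SpureRecAt j`; `hM₂` of `M2Of mixFF j` against `M1At j`) and their remainder classes are DISPLAYED
HYPOTHESES (part A `WardLocusQuarticTable` supplies `hS₂`/`hS₂''` at level `j+1` from the level-`j` kernel law + letters, and at level 0 from letters; `hM₂` is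
an1's (T2-M₂) letter); no statement of Bałaban's papers, no `[cite:]`, no `def`, no `def … : Prop`; instantiates NO binder of the β-function wall.  NOT hW, NOT D1,
NOT `BetaPertH`, NOT continuum, NOT Clay.

DISCHARGED SOCKETS of `divW_W2SymOfK_eq_conjV_add_residuals` (all tree theorems): `hK`/`hC`/`hm` ← `AxialDressingRooted.decays_coDressKBmAt_KInvStep`;
`h𝕄` ← `BorderedHessian.spr_bhKStepAt`; `hE` ← `spr_axEc`; `hR` ← `relInv_coDressKBmAt_KInvStep_bhKStepAt`; `hS` ← `SpineRooted.locStencil_SpureRecAt` (rate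
shrunk); `hM` ← `vertexFamily_M1At`; `hB₂` ← `T2RecAt_loc` + `SecondOrderRemainderTables.abs_le_of_locStencil₂`; `hB₂'` ← `BalabanStepW2.locStencilFM_M2Of` +
`abs_le_of_locStencilFM`; `cH := (stepScale j·Lc^{d+1})⁻¹`, `hH` ← `KernelWardHColumnWall.colH_ward_KInvStep_all`; `hMw` ← `KernelWardMColumn.colM_coDressKBmAt_KInvStep_ward`;
`hoff` ← `KernelWardResponse.coDressKBmAt_KInvStep_inr_inr_off`; `hX` ← `KernelWardLevels.loc_diagK_smul_sum_legInd` + `KernelWardResponse.decays_of_biLoc`; `hXl` ← the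
same; `hEX` ← `comp_axEc_diagK_comm`; `hD` ← `WardLocusQuarticWall.divV_dM_SpureRecAt_M1At_pin` (the first-order law (hD) at the pin, generator scale `½`).

* §1 **`divW_WrecAt_of_tableLaws`**: at the hW Ward pin `(cE, cVH) = (Lc^{d+1}, −Lc^{d+1}·½·Lc^{d+1})`, in-block root, any `cΛ cE₂ cB T`, any localised `vh₂S`,
  `mixFF`, ANY level `j`: the three table laws ⇒ `divW (WrecAt j) y ν y′ = conjV (dM G_j Lc (SpureRecAt j) (M1At j) ν y′) (X y) + ½ • (𝒩 + 𝒩″)` with the residual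
  DISPLAYED (an1's direct residual `𝒩` + leaf-10's swapped residual `𝒩″`), i.e. the induction hypothesis `hWd` of part A's `tableLaw_T2RecAt_succ` at level `j`
  and — by (c1) `dM_SpureRecAt_M1At` — the `hWd` socket of `WardLocusRecursiveEnd` with `X₂ := 0`.
* §2 **`loc_residual_WrecAt`**: the residual is LOCALISED whenever the remainders `R y`, `R″ y` are local-stencil families and `RM y` a vertex family (one
  common rate) — an1's `KernelWardResidual.loc_residual_coDressKBmAt_KInvStep` for `𝒩`, `SecondOrderTransport.loc_dM` ×2 for `𝒩″` — the `h𝒩` input of part A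
  at the next level and the `hNr` socket of the hW END.
* §3 **`wardTransversal_flipK_TbalOf_JsRecWAtOf_of_kernelLaws`** (`d = 3`): the hW END for the W-LITERAL `JsRecWAtOf` — leaf-10's
  `WardLocusRecursiveEnd.wardTransversal_flipK_TbalOf_JsRecBmAtOf_parity` at `W := WrecAt` (`X₂ := 0`, `hW := WrecAt_loc₂`, `hWt := WrecAt_translate`): IF the kernel
  laws `divW (WrecAt j) y ν y′ = conjV (dM G_j …) (X y) + Nr j y ν y′` hold ∀ j with `Nr` localised and row-parity-odd (`trK Nr = −sgnK Nr`), THEN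
  `∀ j, WardTransversal (flipK (TbalOf Lc (JsRecWAtOf …) j))` — hW(v2.26-W) ⟸ EXACTLY the ∀-j kernel laws + the residual's Loc∕parity (+ the binder tables'
  block covariance `hBt`∕`hmixt`).  `conjW 𝕄 0 V X 0 0 = conjV V X` and (c1) `dM_SpureRecAt_M1At` convert the socket shapes.
Provenance: D1 formalisation swarm, leaf prover 06 (gen 3), 2026-08-20; no existing file touched.
-/

noncomputable section

open Finset
open scoped BigOperators
open Literature.MathematicalPhysics.QuantumFieldTheory
open Literature.MathematicalPhysics.QuantumFieldTheory.Balaban1983to89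
open Literature.MathematicalPhysics.QuantumFieldTheory.Balaban1983to89.Beta
open B12Sec2to5 (l1 l1_nonneg)
open B6BondElimination (unitVec)
open ExpKernelCalculus (MKer Decays BiLoc VertexFamily VertexFamily₂ comp)
open KernelWard (divV divW)
open AffineAveraging (Site box toSite)
open OneStepResolventKernel (Fib wsum LocStencil biLoc_mono)
open OneStepKernelFamily (KInvStep colH vertexOfK)
open InterLevelTransport (cwsum)
open BalabanStepJetsSucc (mmRead wE wVH)
open SecondOrderResponse (colM vertexOfM dM K2OfK W2SymOfK LocStencilFM)
open BalabanCompositeJets (LocStencil₂)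
open BalabanStepW2 (M2Of locStencilFM_M2Of wV4 wB2)
open AveragingHessianKernelsRooted (vhSAt)
open Summit.QuantumFields.BalabanUV.Beta.TameKernelCalculus
open Summit.QuantumFields.BalabanUV.Beta.ChartConjugation (conjV loc_conjV)
open Summit.QuantumFields.BalabanUV.Beta.ChartConjugationRelative (RelInv)
open Summit.QuantumFields.BalabanUV.Beta.BorderedHessian (diagK bhKStepAt stepScale spr_bhKStepAt comp_axEc_diagK_comm
  relInv_coDressKBmAt_KInvStep_bhKStepAt)
open Summit.QuantumFields.BalabanUV.Beta.AveragingWardRootedStencils (legInd)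
open Summit.QuantumFields.BalabanUV.Beta.AxialDressingRooted (coDressKBmAt axEc spr_axEc decays_coDressKBmAt_KInvStep)
open Summit.QuantumFields.BalabanUV.Beta.SpineRooted (SpureRecAt M1At T2RecAt WrecAt locStencil_SpureRecAt vertexFamily_M1At T2RecAt_loc)
open Summit.QuantumFields.BalabanUV.Beta.KernelWardRelative (gaugeWt)
open Summit.QuantumFields.BalabanUV.Beta.KernelWardLevels (loc_diagK_smul_sum_legInd)
open Summit.QuantumFields.BalabanUV.Beta.KernelWardHColumnWall (colH_ward_KInvStep_all)
open Summit.QuantumFields.BalabanUV.Beta.KernelWardMColumn (colM_coDressKBmAt_KInvStep_ward)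
open Summit.QuantumFields.BalabanUV.Beta.KernelWardResponse (coDressKBmAt_KInvStep_inr_inr_off decays_of_biLoc)
open Summit.QuantumFields.BalabanUV.Beta.KernelWardResidual (loc_residual_coDressKBmAt_KInvStep)
open Summit.QuantumFields.BalabanUV.Beta.KernelWardSymAssembly (divW_W2SymOfK_eq_conjV_add_residuals)
open Summit.QuantumFields.BalabanUV.Beta.SecondOrderRemainderTables (abs_le_of_locStencil₂ abs_le_of_locStencilFM)
open Summit.QuantumFields.BalabanUV.Beta.WardLocusQuarticWall (dM_SpureRecAt_M1At divV_dM_SpureRecAt_M1At_pin)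
open Summit.QuantumFields.BalabanUV.Beta.WardLocusRecursive (SrecAt)
open Summit.QuantumFields.BalabanUV.Beta.WardLocusRecursiveEnd (wardTransversal_flipK_TbalOf_JsRecBmAtOf_parity)
open Summit.QuantumFields.BalabanUV.Beta.KernelWardRelative (loc_zero comp_zero_left)
open Summit.QuantumFields.BalabanUV.Beta.BorderedHessian (sgnK)
open Summit.QuantumFields.BalabanUV.Beta.ChartConjugation (conjW conjW₁ conjW₂)
open Summit.QuantumFields.BalabanUV.Beta.SpineRooted (JsRecWAtOf CwRecOf δwRecOf δwRecOf_pos WrecAt_loc₂ WrecAt_translate)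
open StepDriftWitness (comp_zero_right)
open ExpKernelCalculus (shiftK)
open PolarizationSign (WardTransversal)
open OneStepKernelFamily (TbalOf flipK)

namespace Summit.QuantumFields.BalabanUV.Beta.WardLocusRecursiveStep

section Wall

variable {d Lc : ℕ} [NeZero Lc]

/-! ## §1 The kernel law of `WrecAt j` from its level-`j` table laws -/

/-- [folklore] **THE SECOND-ORDER WARD KERNEL LAW `hWd j` OF THE W-LITERAL FROM ITS TABLE LAWS, ANY LEVEL `j`.**  At the hW Ward pin
`(cE, cVH) = (Lc^{d+1}, −Lc^{d+1}·½·Lc^{d+1})`, in-block root `ρ = toSite r`, generator `X y = diagK (½ • Σ_{v ∈ box} legInd ρ (Lc•y + v))`, ℋ-column constant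
`cH = (stepScale j·Lc^{d+1})⁻¹`: IF the field table `T2RecAt j` obeys the `hS₂`/`hS₂''` laws against `SpureRecAt j` (remainders `R`, `R″`, bounded) and the mixed table
`M2Of mixFF j` obeys the `hM₂` law against `M1At j` (remainder `RM`, bounded), THEN
`divW (WrecAt j) y ν y′ = conjV (dM G_j Lc (SpureRecAt j) (M1At j) ν y′) (X y) + ½ • (𝒩 y ν y′ + 𝒩″ y ν y′)` with an1's direct residual `𝒩` and leaf-10's swapped residual
`𝒩″` DISPLAYED — `KernelWardSymAssembly.divW_W2SymOfK_eq_conjV_add_residuals` with every other socket a tree theorem (module docstring). -/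
theorem divW_WrecAt_of_tableLaws (hLc : 1 ≤ Lc) {r : Fin (d + 1) → ℕ} (hr : r ∈ box (d + 1) Lc) (cΛ cE₂ cB : ℝ)
    (T : Fin 4 → Fin 4 → Fin 4 → Fin 4 → ℝ)
    {vh₂S : Fin (d + 1) → (Fin (d + 1) → ℤ) → Fin (d + 1) → (Fin (d + 1) → ℤ) → MKer (d + 1) (Fib d)}
    (hB : ∃ C δ : ℝ, 0 < δ ∧ LocStencil₂ vh₂S C δ)
    {mixFF : Fin (d + 1) → (Fin (d + 1) → ℤ) → Fin (d + 1) → (Fin (d + 1) → ℤ) → MKer (d + 1) (Fib d)}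
    (hmix : ∃ C δ : ℝ, 0 < δ ∧ LocStencilFM Lc mixFF C δ) (j : ℕ)
    {R R'' : (Fin (d + 1) → ℤ) → Fin (d + 1) → (Fin (d + 1) → ℤ) → MKer (d + 1) (Fib d)} {BR BR'' : ℝ}
    (hRb : ∀ y κ u x z a b, |R y κ u x z a b| ≤ BR) (hR''b : ∀ y κ u x z a b, |R'' y κ u x z a b| ≤ BR'')
    {RM : (Fin (d + 1) → ℤ) → Fin (d + 1) → (Fin (d + 1) → ℤ) → MKer (d + 1) (Fib d)} {BR' : ℝ}
    (hRMb : ∀ y ρ w x z a b, |RM y ρ w x z a b| ≤ BR')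
    (hS₂ : ∀ (y : Fin (d + 1) → ℤ) (κ' : Fin (d + 1)) (u' : Fin (d + 1) → ℤ),
      (stepScale d Lc j * (Lc : ℝ) ^ (d + 1))⁻¹ • ∑ v ∈ box (d + 1) Lc, divV (fun κ u =>
          T2RecAt d Lc (toSite r) ((Lc : ℝ) ^ (d + 1)) (-((Lc : ℝ) ^ (d + 1) * (1 / 2) * (Lc : ℝ) ^ (d + 1))) cΛ cE₂ cB T vh₂S mixFF j κ u κ' u')
          ((Lc : ℤ) • y + toSite v) =
        comp (SpureRecAt d Lc (toSite r) ((Lc : ℝ) ^ (d + 1)) (-((Lc : ℝ) ^ (d + 1) * (1 / 2) * (Lc : ℝ) ^ (d + 1))) cΛ j κ' u')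
            (diagK (((1 : ℝ) / 2) • ∑ v ∈ box (d + 1) Lc, legInd (toSite r) ((Lc : ℤ) • y + toSite v)))
          - comp (diagK (((1 : ℝ) / 2) • ∑ v ∈ box (d + 1) Lc, legInd (toSite r) ((Lc : ℤ) • y + toSite v)))
            (SpureRecAt d Lc (toSite r) ((Lc : ℝ) ^ (d + 1)) (-((Lc : ℝ) ^ (d + 1) * (1 / 2) * (Lc : ℝ) ^ (d + 1))) cΛ j κ' u')
          + R y κ' u')
    (hS₂'' : ∀ (y : Fin (d + 1) → ℤ) (κ : Fin (d + 1)) (u : Fin (d + 1) → ℤ),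
      (stepScale d Lc j * (Lc : ℝ) ^ (d + 1))⁻¹ • ∑ v ∈ box (d + 1) Lc, divV
          (T2RecAt d Lc (toSite r) ((Lc : ℝ) ^ (d + 1)) (-((Lc : ℝ) ^ (d + 1) * (1 / 2) * (Lc : ℝ) ^ (d + 1))) cΛ cE₂ cB T vh₂S mixFF j κ u)
          ((Lc : ℤ) • y + toSite v) =
        comp (SpureRecAt d Lc (toSite r) ((Lc : ℝ) ^ (d + 1)) (-((Lc : ℝ) ^ (d + 1) * (1 / 2) * (Lc : ℝ) ^ (d + 1))) cΛ j κ u)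
            (diagK (((1 : ℝ) / 2) • ∑ v ∈ box (d + 1) Lc, legInd (toSite r) ((Lc : ℤ) • y + toSite v)))
          - comp (diagK (((1 : ℝ) / 2) • ∑ v ∈ box (d + 1) Lc, legInd (toSite r) ((Lc : ℤ) • y + toSite v)))
            (SpureRecAt d Lc (toSite r) ((Lc : ℝ) ^ (d + 1)) (-((Lc : ℝ) ^ (d + 1) * (1 / 2) * (Lc : ℝ) ^ (d + 1))) cΛ j κ u)
          + R'' y κ u)
    (hM₂ : ∀ (y : Fin (d + 1) → ℤ) (ρ' : Fin (d + 1)) (w : Fin (d + 1) → ℤ),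
      (stepScale d Lc j * (Lc : ℝ) ^ (d + 1))⁻¹ • ∑ v ∈ box (d + 1) Lc, divV (fun κ u => M2Of d Lc mixFF j κ u ρ' w) ((Lc : ℤ) • y + toSite v) =
        comp (M1At d Lc (toSite r) cΛ j ρ' w) (diagK (((1 : ℝ) / 2) • ∑ v ∈ box (d + 1) Lc, legInd (toSite r) ((Lc : ℤ) • y + toSite v)))
          - comp (diagK (((1 : ℝ) / 2) • ∑ v ∈ box (d + 1) Lc, legInd (toSite r) ((Lc : ℤ) • y + toSite v))) (M1At d Lc (toSite r) cΛ j ρ' w)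
          + RM y ρ' w)
    (y : Fin (d + 1) → ℤ) (ν : Fin (d + 1)) (y' : Fin (d + 1) → ℤ) :
    divW (WrecAt d Lc (toSite r) ((Lc : ℝ) ^ (d + 1)) (-((Lc : ℝ) ^ (d + 1) * (1 / 2) * (Lc : ℝ) ^ (d + 1))) cΛ cE₂ cB T vh₂S mixFF j) y ν y' =
      conjV (dM (coDressKBmAt (toSite r) Lc (KInvStep (d := d) Lc j)) Lc
            (SpureRecAt d Lc (toSite r) ((Lc : ℝ) ^ (d + 1)) (-((Lc : ℝ) ^ (d + 1) * (1 / 2) * (Lc : ℝ) ^ (d + 1))) cΛ j)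
            (M1At d Lc (toSite r) cΛ j) ν y')
          (diagK (((1 : ℝ) / 2) • ∑ v ∈ box (d + 1) Lc, legInd (toSite r) ((Lc : ℤ) • y + toSite v)))
        + (1 / 2 : ℝ) • (
          (dM (coDressKBmAt (toSite r) Lc (KInvStep (d := d) Lc j)) Lc (R y) (RM y) ν y'
            - (stepScale d Lc j * (Lc : ℝ) ^ (d + 1))⁻¹ • (∑ κ, wsum (fun u => ∑' x₂, ∑ κ₂,
                comp (coDressKBmAt (toSite r) Lc (KInvStep (d := d) Lc j))
                  (dM (coDressKBmAt (toSite r) Lc (KInvStep (d := d) Lc j)) Lc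
                    (SpureRecAt d Lc (toSite r) ((Lc : ℝ) ^ (d + 1)) (-((Lc : ℝ) ^ (d + 1) * (1 / 2) * (Lc : ℝ) ^ (d + 1))) cΛ j)
                    (M1At d Lc (toSite r) cΛ j) ν y') u x₂ (Sum.inl κ) (Sum.inl κ₂) * gaugeWt Lc y κ₂ x₂)
                (SpureRecAt d Lc (toSite r) ((Lc : ℝ) ^ (d + 1)) (-((Lc : ℝ) ^ (d + 1) * (1 / 2) * (Lc : ℝ) ^ (d + 1))) cΛ j κ)
              + ∑ ρ', cwsum Lc (fun w => ∑' x₂, ∑ κ₂,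
                comp (coDressKBmAt (toSite r) Lc (KInvStep (d := d) Lc j))
                  (dM (coDressKBmAt (toSite r) Lc (KInvStep (d := d) Lc j)) Lc
                    (SpureRecAt d Lc (toSite r) ((Lc : ℝ) ^ (d + 1)) (-((Lc : ℝ) ^ (d + 1) * (1 / 2) * (Lc : ℝ) ^ (d + 1))) cΛ j)
                    (M1At d Lc (toSite r) cΛ j) ν y') ((Lc : ℤ) • w) x₂ (Sum.inr ρ') (Sum.inl κ₂) * gaugeWt Lc y κ₂ x₂)
                (M1At d Lc (toSite r) cΛ j ρ')))
          + (dM (coDressKBmAt (toSite r) Lc (KInvStep (d := d) Lc j)) Lc (R'' y) (RM y) ν y'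
            + dM (conjV (coDressKBmAt (toSite r) Lc (KInvStep (d := d) Lc j))
                (diagK (((1 : ℝ) / 2) • ∑ v ∈ box (d + 1) Lc, legInd (toSite r) ((Lc : ℤ) • y + toSite v)))) Lc
              (SpureRecAt d Lc (toSite r) ((Lc : ℝ) ^ (d + 1)) (-((Lc : ℝ) ^ (d + 1) * (1 / 2) * (Lc : ℝ) ^ (d + 1))) cΛ j)
              (M1At d Lc (toSite r) cΛ j) ν y')) := by
  set cE : ℝ := (Lc : ℝ) ^ (d + 1) with hcE
  set cVH : ℝ := -((Lc : ℝ) ^ (d + 1) * (1 / 2) * (Lc : ℝ) ^ (d + 1)) with hcVH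
  -- the propagator's decay, the first-order tables' classes at one common rate `m := min δs δK`
  obtain ⟨δK, CK, hδK, hCK, hKd⟩ := decays_coDressKBmAt_KInvStep (d := d) hr j
  obtain ⟨Cs, δs, hδs, hS⟩ := locStencil_SpureRecAt (d := d) hLc hr cE cVH cΛ j
  have hm : 0 < min δs δK := lt_min hδs hδK
  have hKd' : Decays (coDressKBmAt (toSite r) Lc (KInvStep (d := d) Lc j)) CK (min δs δK) :=
    OneStepResolventKernel.decays_mono hKd hCK le_rfl (min_le_right δs δK)
  have hS' : LocStencil (SpureRecAt d Lc (toSite r) cE cVH cΛ j) (|Cs|) (min δs δK) :=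
    fun κ u => biLoc_of_le (hS κ u) (min_le_left δs δK)
  have hM' := vertexFamily_M1At hLc hr cΛ j hm.le
  -- bounds of the second-order tables
  obtain ⟨C₂, δ₂, hδ₂, hT₂⟩ := T2RecAt_loc cE cVH cΛ cE₂ cB T vh₂S mixFF hLc hr hB hmix j
  obtain ⟨CM, δM, hδM, hmixl⟩ := hmix
  have hB₂ : ∀ κ u κ' u' x z a b, |T2RecAt d Lc (toSite r) cE cVH cΛ cE₂ cB T vh₂S mixFF j κ u κ' u' x z a b| ≤ C₂ :=
    fun κ u κ' u' x z a b => abs_le_of_locStencil₂ hT₂ hδ₂.le κ u κ' u' x z a b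
  have hB₂' : ∀ κ u ρ' w x z a b, |M2Of d Lc mixFF j κ u ρ' w x z a b| ≤ |BalabanStepW2.wM2 d Lc j| * CM :=
    fun κ u ρ' w x z a b => abs_le_of_locStencilFM (locStencilFM_M2Of hmixl j) hδM.le κ u ρ' w x z a b
  -- the generator: spread (from its localisation), localised, commuting with the axial projector
  have hXl : ∀ y : Fin (d + 1) → ℤ, Loc (diagK (((1 : ℝ) / 2) • ∑ v ∈ box (d + 1) Lc, legInd (toSite r) ((Lc : ℤ) • y + toSite v))) :=
    fun y => loc_diagK_smul_sum_legInd Lc (toSite r) _ y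
  have hX : ∀ y : Fin (d + 1) → ℤ, Spr (diagK (((1 : ℝ) / 2) • ∑ v ∈ box (d + 1) Lc, legInd (toSite r) ((Lc : ℤ) • y + toSite v))) := by
    intro y
    obtain ⟨p, q, C, δ, hδ, hpq⟩ := hXl y
    exact ⟨_, δ, hδ, decays_of_biLoc hpq hδ.le⟩
  exact divW_W2SymOfK_eq_conjV_add_residuals hKd' hCK hm (spr_bhKStepAt hr j) (spr_axEc _ _) (relInv_coDressKBmAt_KInvStep_bhKStepAt hr j)
    hS' hM' hB₂ hB₂' ((stepScale d Lc j * (Lc : ℝ) ^ (d + 1))⁻¹) (fun y κ' u => colH_ward_KInvStep_all hr j y κ' u)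
    (fun y ρ' w => colM_coDressKBmAt_KInvStep_ward (toSite r) j y ρ' w)
    (fun x hx z ρ' μ => coDressKBmAt_KInvStep_inr_inr_off (toSite r) j x hx z ρ' μ) hX hXl (fun y => comp_axEc_diagK_comm _ _ _)
    (divV_dM_SpureRecAt_M1At_pin hr cΛ j) hRb hR''b hRMb hS₂ hS₂'' hM₂ y ν y'

/-! ## §2 The residual is localised -/

/-- [folklore] **THE RESIDUAL OF `hWd j` IS LOCALISED** (the `h𝒩` input of part A at level `j+1`, the `hNr` socket of the hW END): for remainders `R y`, `R″ y`
local-stencil families and `RM y` a vertex family at one rate `mR > 0` (any constants), the displayed residual `½ • (𝒩 + 𝒩″)` of `divW_WrecAt_of_tableLaws` is `Loc`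
at every `(y, ν, y′)` — an1's `KernelWardResidual.loc_residual_coDressKBmAt_KInvStep` for `𝒩` (tables shrunk to the common rate `min mR δs`), `SecondOrderTransport.loc_dM`
for the two vertices of `𝒩″` (the rotated one over the spread kernel `conjV G_j (X y)`, whose decay is `decays_of_biLoc ∘ loc_conjV`). -/
theorem loc_residual_WrecAt (hLc : 1 ≤ Lc) {r : Fin (d + 1) → ℕ} (hr : r ∈ box (d + 1) Lc) (cΛ : ℝ) (j : ℕ)
    {R R'' : (Fin (d + 1) → ℤ) → Fin (d + 1) → (Fin (d + 1) → ℤ) → MKer (d + 1) (Fib d)}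
    {RM : (Fin (d + 1) → ℤ) → Fin (d + 1) → (Fin (d + 1) → ℤ) → MKer (d + 1) (Fib d)} {CR CR'' CRM mR : ℝ} (hmR : 0 < mR)
    (hRl : ∀ y, LocStencil (R y) CR mR) (hR''l : ∀ y, LocStencil (R'' y) CR'' mR) (hRMl : ∀ y, VertexFamily (RM y) Lc CRM mR)
    (y : Fin (d + 1) → ℤ) (ν : Fin (d + 1)) (y' : Fin (d + 1) → ℤ) :
    Loc ((1 / 2 : ℝ) • (
          (dM (coDressKBmAt (toSite r) Lc (KInvStep (d := d) Lc j)) Lc (R y) (RM y) ν y'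
            - (stepScale d Lc j * (Lc : ℝ) ^ (d + 1))⁻¹ • (∑ κ, wsum (fun u => ∑' x₂, ∑ κ₂,
                comp (coDressKBmAt (toSite r) Lc (KInvStep (d := d) Lc j))
                  (dM (coDressKBmAt (toSite r) Lc (KInvStep (d := d) Lc j)) Lc
                    (SpureRecAt d Lc (toSite r) ((Lc : ℝ) ^ (d + 1)) (-((Lc : ℝ) ^ (d + 1) * (1 / 2) * (Lc : ℝ) ^ (d + 1))) cΛ j)
                    (M1At d Lc (toSite r) cΛ j) ν y') u x₂ (Sum.inl κ) (Sum.inl κ₂) * gaugeWt Lc y κ₂ x₂)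
                (SpureRecAt d Lc (toSite r) ((Lc : ℝ) ^ (d + 1)) (-((Lc : ℝ) ^ (d + 1) * (1 / 2) * (Lc : ℝ) ^ (d + 1))) cΛ j κ)
              + ∑ ρ', cwsum Lc (fun w => ∑' x₂, ∑ κ₂,
                comp (coDressKBmAt (toSite r) Lc (KInvStep (d := d) Lc j))
                  (dM (coDressKBmAt (toSite r) Lc (KInvStep (d := d) Lc j)) Lc
                    (SpureRecAt d Lc (toSite r) ((Lc : ℝ) ^ (d + 1)) (-((Lc : ℝ) ^ (d + 1) * (1 / 2) * (Lc : ℝ) ^ (d + 1))) cΛ j)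
                    (M1At d Lc (toSite r) cΛ j) ν y') ((Lc : ℤ) • w) x₂ (Sum.inr ρ') (Sum.inl κ₂) * gaugeWt Lc y κ₂ x₂)
                (M1At d Lc (toSite r) cΛ j ρ')))
          + (dM (coDressKBmAt (toSite r) Lc (KInvStep (d := d) Lc j)) Lc (R'' y) (RM y) ν y'
            + dM (conjV (coDressKBmAt (toSite r) Lc (KInvStep (d := d) Lc j))
                (diagK (((1 : ℝ) / 2) • ∑ v ∈ box (d + 1) Lc, legInd (toSite r) ((Lc : ℤ) • y + toSite v)))) Lc
              (SpureRecAt d Lc (toSite r) ((Lc : ℝ) ^ (d + 1)) (-((Lc : ℝ) ^ (d + 1) * (1 / 2) * (Lc : ℝ) ^ (d + 1))) cΛ j)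
              (M1At d Lc (toSite r) cΛ j) ν y'))) := by
  set cE : ℝ := (Lc : ℝ) ^ (d + 1) with hcE
  set cVH : ℝ := -((Lc : ℝ) ^ (d + 1) * (1 / 2) * (Lc : ℝ) ^ (d + 1)) with hcVH
  obtain ⟨δK, CK, hδK, hCK, hKd⟩ := decays_coDressKBmAt_KInvStep (d := d) hr j
  obtain ⟨Cs, δs, hδs, hS⟩ := locStencil_SpureRecAt (d := d) hLc hr cE cVH cΛ j
  -- one common rate for `S`, `M`, `R`, `R''`, `RM` (and below the kernels)
  set m : ℝ := min mR (min δs δK) with hmdef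
  have hm : 0 < m := lt_min hmR (lt_min hδs hδK)
  have hmR' : m ≤ mR := min_le_left _ _
  have hmS : m ≤ δs := (min_le_right _ _).trans (min_le_left _ _)
  have hmK : m ≤ δK := (min_le_right _ _).trans (min_le_right _ _)
  have hS' : LocStencil (SpureRecAt d Lc (toSite r) cE cVH cΛ j) (|Cs|) m := fun κ u => biLoc_of_le (hS κ u) hmS
  have hM' := vertexFamily_M1At hLc hr cΛ j hm.le
  have hRl' : ∀ y, LocStencil (R y) (|CR|) m := fun y κ u => biLoc_of_le (hRl y κ u) hmR'
  have hR''l' : ∀ y, LocStencil (R'' y) (|CR''|) m := fun y κ u => biLoc_of_le (hR''l y κ u) hmR'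
  have hRMl' : ∀ y, VertexFamily (RM y) Lc (|CRM|) m := fun y ρ' w => biLoc_of_le (hRMl y ρ' w) hmR'
  -- 𝒩 (an1's residual, wall instance)
  have h𝒩 := loc_residual_coDressKBmAt_KInvStep (d := d) hr j hm hS' hM' hRl' hRMl' y ν y'
  -- 𝒩″: two differentiated vertices
  have hKd' : Decays (coDressKBmAt (toSite r) Lc (KInvStep (d := d) Lc j)) CK m := OneStepResolventKernel.decays_mono hKd hCK le_rfl hmK
  have h1 : Loc (dM (coDressKBmAt (toSite r) Lc (KInvStep (d := d) Lc j)) Lc (R'' y) (RM y) ν y') :=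
    SecondOrderTransport.loc_dM hKd' hCK (hR''l' y) (hRMl' y) hm le_rfl ν y'
  have hXl : Loc (diagK (((1 : ℝ) / 2) • ∑ v ∈ box (d + 1) Lc, legInd (toSite r) ((Lc : ℤ) • y + toSite v))) :=
    loc_diagK_smul_sum_legInd Lc (toSite r) _ y
  have hKs : Spr (coDressKBmAt (toSite r) Lc (KInvStep (d := d) Lc j)) := ⟨CK, δK, hδK, hKd⟩
  obtain ⟨p, q, CV, δV, hδV, hV⟩ := loc_conjV hKs hXl
  have hVd := decays_of_biLoc hV hδV.le
  have hm' : 0 < min m δV := lt_min hm hδV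
  have h2 : Loc (dM (conjV (coDressKBmAt (toSite r) Lc (KInvStep (d := d) Lc j))
        (diagK (((1 : ℝ) / 2) • ∑ v ∈ box (d + 1) Lc, legInd (toSite r) ((Lc : ℤ) • y + toSite v)))) Lc
      (SpureRecAt d Lc (toSite r) cE cVH cΛ j) (M1At d Lc (toSite r) cΛ j) ν y') :=
    SecondOrderTransport.loc_dM hVd (mul_nonneg (hV.nonneg (Sum.inl 0)) (Real.exp_pos _).le)
      (fun κ u => biLoc_of_le (hS κ u) ((min_le_left _ _).trans hmS)) (vertexFamily_M1At hLc hr cΛ j hm'.le) hm' (min_le_right _ _) ν y'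
  exact ((h𝒩.add (h1.add h2)).smul (1 / 2 : ℝ))

/-! ## §3 The hW END for the W-literal from the ∀-`j` kernel laws (`d = 3`) -/

/-- [folklore] `conjW 𝕄 0 V X 0 0 = conjV V X` — the second-order contact with the first vertex, the second generator and the second symbol all zero
is the first-order contact of the remaining vertex (`comp_zero_left`/`comp_zero_right`). -/
theorem conjW_zero_zero_zero {D : ℕ} {F : Type*} [Fintype F] [DecidableEq F] (𝕄 V X : MKer D F) : conjW 𝕄 0 V X 0 0 = conjV V X := by
  unfold ChartConjugation.conjW ChartConjugation.conjW₁ ChartConjugation.conjW₂ ChartConjugation.conjV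
  simp only [comp_zero_left, comp_zero_right, add_zero, sub_self]

/-- [folklore] **hW FOR THE W-LITERAL `JsRecWAtOf` FROM THE ∀-`j` KERNEL LAWS OF `WrecAt`** (`d = 3`, `Lc ≥ 1`, in-block root `ρ = toSite r`, the hW Ward pin
`(cE, cVH) = (Lc⁴, −Lc⁴·½·Lc⁴)`, any `cΛ cE₂ cB T`, localised block-covariant binder tables `vh₂S`, `mixFF`).  HYPOTHESES (displayed): for every level `j` the
second-order Ward KERNEL law of `WrecAt j` in the `conjV` form of §1 with a residual family `Nr j` (`hWdV`), `Nr` localised (`hNr`) and row-parity-odd (`hNt`,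
an1's ROOT′ discipline).  CONCLUSION: `∀ j, WardTransversal (flipK (TbalOf Lc (JsRecWAtOf hLc hr Lc⁴ (−Lc⁴·½·Lc⁴) cΛ cE₂ cB T hB hmix) j))` —
`WardLocusRecursiveEnd.wardTransversal_flipK_TbalOf_JsRecBmAtOf_parity` at `W := WrecAt`, `X₂ := 0` (`loc_zero`), `hW := WrecAt_loc₂`, `hWt := WrecAt_translate`,
the socket shapes matched by `conjW_zero_zero_zero` and (c1) `WardLocusQuarticWall.dM_SpureRecAt_M1At`.  hW(v2.26-W) is thereby REDUCED to the ∀-`j` kernel laws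
(§1: per level ⟸ three table laws; part A: table laws at `j+1` ⟸ kernel law at `j` + letters + pin, at `0` ⟸ letters) and the residual classes; NOT closed. -/
theorem wardTransversal_flipK_TbalOf_JsRecWAtOf_of_kernelLaws {Lc : ℕ} [NeZero Lc] (hLc : 1 ≤ Lc) {r : Fin (3 + 1) → ℕ}
    (hr : r ∈ box (3 + 1) Lc) (cΛ cE₂ cB : ℝ) (T : Fin 4 → Fin 4 → Fin 4 → Fin 4 → ℝ)
    {vh₂S : Fin (3 + 1) → (Fin (3 + 1) → ℤ) → Fin (3 + 1) → (Fin (3 + 1) → ℤ) → MKer (3 + 1) (Fib 3)}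
    (hB : ∃ C δ : ℝ, 0 < δ ∧ LocStencil₂ vh₂S C δ)
    (hBt : ∀ (κ : Fin (3 + 1)) (u : Fin (3 + 1) → ℤ) (κ' : Fin (3 + 1)) (u' t : Fin (3 + 1) → ℤ),
      vh₂S κ (u + (Lc : ℤ) • t) κ' (u' + (Lc : ℤ) • t) = shiftK (-((Lc : ℤ) • t)) (vh₂S κ u κ' u'))
    {mixFF : Fin (3 + 1) → (Fin (3 + 1) → ℤ) → Fin (3 + 1) → (Fin (3 + 1) → ℤ) → MKer (3 + 1) (Fib 3)}
    (hmix : ∃ C δ : ℝ, 0 < δ ∧ LocStencilFM Lc mixFF C δ)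
    (hmixt : ∀ (κ : Fin (3 + 1)) (u : Fin (3 + 1) → ℤ) (μ : Fin (3 + 1)) (w t : Fin (3 + 1) → ℤ),
      mixFF κ (u + (Lc : ℤ) • t) μ (w + t) = shiftK (-((Lc : ℤ) • t)) (mixFF κ u μ w))
    (Nr : ℕ → (Fin 4 → ℤ) → Fin 4 → (Fin 4 → ℤ) → MKer 4 (Fib 3)) (hNr : ∀ j y ν y', Loc (Nr j y ν y'))
    (hNt : ∀ j y ν y', trK (Nr j y ν y') = -sgnK (Nr j y ν y'))
    (hWdV : ∀ (j : ℕ) (y : Fin 4 → ℤ) (ν : Fin 4) (y' : Fin 4 → ℤ),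
      divW (WrecAt 3 Lc (toSite r) ((Lc : ℝ) ^ (3 + 1)) (-((Lc : ℝ) ^ (3 + 1) * (1 / 2) * (Lc : ℝ) ^ (3 + 1))) cΛ cE₂ cB T vh₂S mixFF j) y ν y' =
        conjV (dM (coDressKBmAt (toSite r) Lc (KInvStep (d := 3) Lc j)) Lc
            (SpureRecAt 3 Lc (toSite r) ((Lc : ℝ) ^ (3 + 1)) (-((Lc : ℝ) ^ (3 + 1) * (1 / 2) * (Lc : ℝ) ^ (3 + 1))) cΛ j)
            (M1At 3 Lc (toSite r) cΛ j) ν y')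
          (diagK (((1 : ℝ) / 2) • ∑ v ∈ box (3 + 1) Lc, legInd (toSite r) ((Lc : ℤ) • y + toSite v))) + Nr j y ν y') :
    ∀ j : ℕ, WardTransversal (flipK (TbalOf Lc
      (JsRecWAtOf (d := 3) hLc hr ((Lc : ℝ) ^ (3 + 1)) (-((Lc : ℝ) ^ (3 + 1) * (1 / 2) * (Lc : ℝ) ^ (3 + 1))) cΛ cE₂ cB T hB hmix) j)) := by
  have hL : (Lc : ℝ) ^ (3 + 1) ≠ 0 := pow_ne_zero _ (Nat.cast_ne_zero.2 (NeZero.ne Lc))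
  have hξ : (Lc : ℝ) ^ (3 + 1) * (1 / 2) / (Lc : ℝ) ^ (3 + 1) = (1 : ℝ) / 2 := by
    field_simp
  have hEX₂ : ∀ (j : ℕ) (y : Fin 4 → ℤ) (ν : Fin 4) (y' : Fin 4 → ℤ),
      comp (axEc (toSite r) Lc) ((fun (_ : ℕ) (_ : Fin 4 → ℤ) (_ : Fin 4) (_ : Fin 4 → ℤ) => (0 : MKer 4 (Fib 3))) j y ν y') =
        comp ((fun (_ : ℕ) (_ : Fin 4 → ℤ) (_ : Fin 4) (_ : Fin 4 → ℤ) => (0 : MKer 4 (Fib 3))) j y ν y') (axEc (toSite r) Lc) := by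
    intro j y ν y'
    simp only [comp_zero_left, comp_zero_right]
  exact wardTransversal_flipK_TbalOf_JsRecBmAtOf_parity hLc hr cΛ rfl rfl
    (WrecAt 3 Lc (toSite r) ((Lc : ℝ) ^ (3 + 1)) (-((Lc : ℝ) ^ (3 + 1) * (1 / 2) * (Lc : ℝ) ^ (3 + 1))) cΛ cE₂ cB T vh₂S mixFF)
    (CwRecOf hLc hr _ _ cΛ cE₂ cB T hB hmix) (δwRecOf hLc hr _ _ cΛ cE₂ cB T hB hmix) (δwRecOf_pos hLc hr _ _ cΛ cE₂ cB T hB hmix)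
    (WrecAt_loc₂ hLc hr _ _ cΛ cE₂ cB T hB hmix)
    (fun j μ y ν y' t => WrecAt_translate (toSite r) _ _ cΛ cE₂ cB T vh₂S mixFF hLc hBt hmixt j μ y ν y' t)
    (fun _ _ _ _ => 0) Nr (fun _ _ _ _ => loc_zero) hNr hEX₂
    (fun j y ν y' => by
      rw [hξ, conjW_zero_zero_zero, ← dM_SpureRecAt_M1At hr _ _ cΛ j ν y']
      exact hWdV j y ν y')
    hNt

end Wall

end Summit.QuantumFields.BalabanUV.Beta.WardLocusRecursiveStep

end
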